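import Literature.MathematicalPhysics.QuantumFieldTheory.OSLaplaceSchwinger
import Literature.Analysis.Distribution.FourierLaplaceBoundaryLimit
import Literature.MathematicalPhysics.QuantumFieldTheory.OSLorentzInvariance
import Mathlib.Analysis.LocallyConvex.Separation
import HarnessLib

/-!
# Density of the Laplace transforms of positive-time Euclidean test functions (OS I, Lemma 4.1)

Topic `Literature/MathematicalPhysics/QuantumFieldTheory`; fourth file towards
`OS1973_wightmanVectors` (Osterwalder–Schrader I (1973), §4.3). Osterwalder–Schrader, Lemma 4.1:
"The map `f ↦ f̃` for `f ∈ 𝒮₊` is a continuous map of `𝒮₊` onto a dense subset `𝒮̃` of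
`𝒮(ℝ̄₊^{4n})`", proved from Lemma 8.2 (density of Laplace transforms of `𝒮(ℝ₊)` in `𝒮(ℝ̄₊)`: a
functional `W` annihilating all transforms is, through its Fourier–Laplace transform analytic in
the upper half plane and vanishing on the imaginary axis, identically zero — Hahn–Banach) and the
Remark that Lemmas 8.1–8.4 "can immediately be generalized to the case of several variables".

In the tree's vocabulary, with the Laplace transforms `g̃ = laplaceTestR d m g`
(`OSLaplaceSchwinger`; `g̃ = χ_R · rawLaplace g`, `χ_R` the fixed smooth cutoff of the flattened OS
momentum set `R = flatten '' osMomentumSet d m`) of the test functions `g` smooth and compactly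
supported in the positive time-ordered region (`osTestSet d m`): **for every Schwartz `ψ` on
`(ℝ^{1+d})ᵐ`, `χ_R · ψ` lies in the closure of the span of `{g̃}`**
(`cutoffR_mem_closure_laplaceSpan`). Proof (OS's, several variables, in the flattened Fourier
picture): if not, Hahn–Banach in the locally convex space `𝓢` (Mathlib's
`RCLike.geometric_hahn_banach_point_closed`) gives a continuous linear `W` vanishing on the closed
span with `W(χ_R ψ) ≠ 0` (`exists_clm_eq_zero_of_notMem`); its Fourier–Laplace transform
`Φ(z) = W(unflatten (χ_R e^{−2πi⟨z,·⟩}))` is holomorphic on the forward tube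
(`differentiableOn_fourierLaplaceFun`) and `W(g̃) = ∫ g(x) Φ(ι x) dx` (`clm_laplaceTest`), so `Φ`
vanishes at all positive time-ordered Euclidean points (`eqOn_of_integral_mul_eq_of_isOpen`),
hence on the tube (`eqOn_zero_forwardTube_of_euclidean`), hence `W(unflatten (χ_R ψ')) = 0` for
every `ψ'` by the boundary limit along a ray (`fourierInvDual_smulLeft_coneCutoff_eq_zero`) —
contradicting `W(χ_R ψ) ≠ 0`.

## References

* K. Osterwalder, R. Schrader, *Axioms for Euclidean Green's functions*, Comm. Math. Phys. 31
  (1973) 83–112, §4.3 Lemma 4.1, §8 Lemma 8.2 and the Remark after Lemma 8.4.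
  [OsterwalderSchraderCMP1973]
-/

noncomputable section

open Set Filter Complex MeasureTheory SchwartzMap
open _root_.Topology
open scoped SchwartzMap RealInnerProductSpace ComplexConjugate ContDiff FourierTransform
open Literature.MathematicalPhysics.QuantumLattice Literature.MathematicalPhysics.QuantumFieldTheory
open Literature.Analysis.FunctionSpaces Literature.Analysis.Distribution

namespace Literature.MathematicalPhysics.QuantumFieldTheory

variable {d m : ℕ}

/-! ### The test functions, their transforms and the cutoff -/

variable (d m) in
/-- **The positive-time-ordered Euclidean test functions** `𝒮₊((ℝ^{d+1})ᵐ)` of Osterwalder–Schrader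
in compactly supported form: Schwartz functions with compact support contained in the open
region `{0 < x⁰₀ < x⁰₁ < ⋯ < x⁰_{m−1}}` (OS I (1973), §2 p. 86, the space `𝒮_{0∞}`; its compactly
supported elements are dense). [cite: OsterwalderSchraderCMP1973, §2 p. 86] -/
def osTestSet : Set 𝓢((Fin m → SpaceTime d), ℂ) :=
  {g | HasCompactSupport (g : (Fin m → SpaceTime d) → ℂ) ∧
    tsupport (g : (Fin m → SpaceTime d) → ℂ) ⊆ timeOrderedRegion d m}

variable (d m) in
/-- **The span of the Laplace transforms** `{g̃ : g ∈ osTestSet}` (OS I (1973), Lemma 4.1, the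
subspace `𝒮̃`). [cite: OsterwalderSchraderCMP1973, §4.3 Lemma 4.1] -/
def laplaceSpan : Submodule ℂ 𝓢((Fin m → SpaceTime d), ℂ) :=
  Submodule.span ℂ ((fun g : 𝓢((Fin m → SpaceTime d), ℂ) => laplaceTestR d m g) '' osTestSet d m)

variable (d m) in
/-- Multiplication by the cutoff `χ_R ∘ flatten` of the OS momentum set — the tree's form of
OS's restriction to `{q⁰ₖ ≥ 0}` (OS I (1973), (4.26), `f̂|_{q⁰ ≥ 0}`). [cite: OsterwalderSchraderCMP1973, §4.3 eq. (4.26)] -/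
def cutoffR : 𝓢((Fin m → SpaceTime d), ℂ) →L[ℂ] 𝓢((Fin m → SpaceTime d), ℂ) :=
  SchwartzMap.smulLeftCLM ℂ fun ξ => (coneCutoff (flatOsMomentumSet d m) (flattenCLE d m ξ) : ℂ)

/-- The cutoff multiplier has temperate growth. [folklore] -/
theorem hasTemperateGrowth_cutoffR :
    Function.HasTemperateGrowth fun ξ : Fin m → SpaceTime d =>
      (coneCutoff (flatOsMomentumSet d m) (flattenCLE d m ξ) : ℂ) :=
  (hasTemperateGrowth_coneCutoff (flatOsMomentumSet d m)).comp
    (flattenCLE d m).toContinuousLinearMap.hasTemperateGrowth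

/-- Pointwise formula. [folklore] -/
@[simp]
theorem cutoffR_apply (ψ : 𝓢((Fin m → SpaceTime d), ℂ)) (ξ : Fin m → SpaceTime d) :
    cutoffR d m ψ ξ = (coneCutoff (flatOsMomentumSet d m) (flattenCLE d m ξ) : ℂ) * ψ ξ := by
  rw [cutoffR, SchwartzMap.smulLeftCLM_apply_apply hasTemperateGrowth_cutoffR, smul_eq_mul]

/-- `cutoffR ψ` is the un-flattening of `χ_R · flatten ψ`. [folklore] -/
theorem cutoffR_eq_unflattenCLM (ψ : 𝓢((Fin m → SpaceTime d), ℂ)) :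
    cutoffR d m ψ = unflattenCLM d m
      (SchwartzMap.smulLeftCLM ℂ (fun ξ => (coneCutoff (flatOsMomentumSet d m) ξ : ℂ)) (flattenTest ψ)) := by
  ext ξ
  rw [cutoffR_apply, unflattenCLM_apply,
    SchwartzMap.smulLeftCLM_apply_apply (hasTemperateGrowth_coneCutoff _), smul_eq_mul,
    flattenTest_apply, ContinuousLinearEquiv.symm_apply_apply]

/-! ### A functional vanishing on a closed subspace but not at a point outside it -/

/-- **Hahn–Banach for a closed subspace of Schwartz space**: a point outside the closure of a
submodule is separated from it by a continuous linear functional vanishing on the submodule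
(Mathlib's `RCLike.geometric_hahn_banach_point_closed` in the locally convex space `𝓢`, plus the
observation that a real part bounded below on a complex subspace vanishes there). [folklore] -/
theorem exists_clm_eq_zero_of_notMem {V : Type*} [NormedAddCommGroup V] [NormedSpace ℝ V]
    (M : Submodule ℂ 𝓢(V, ℂ)) {x : 𝓢(V, ℂ)} (hx : x ∉ closure (M : Set 𝓢(V, ℂ))) :
    ∃ W : 𝓢(V, ℂ) →L[ℂ] ℂ, (∀ b ∈ closure (M : Set 𝓢(V, ℂ)), W b = 0) ∧ W x ≠ 0 := by
  have hconv : Convex ℝ (closure (M : Set 𝓢(V, ℂ))) := (M.restrictScalars ℝ).convex.closure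
  obtain ⟨f, u, hfx, hfb⟩ :=
    RCLike.geometric_hahn_banach_point_closed (𝕜 := ℂ) hconv isClosed_closure hx
  have h0 : (0 : 𝓢(V, ℂ)) ∈ closure (M : Set 𝓢(V, ℂ)) := subset_closure M.zero_mem
  have hu0 : u < 0 := by simpa using hfb 0 h0
  -- the real part of `f` is bounded below on the closed subspace, hence `f` vanishes there
  have hzero : ∀ b ∈ closure (M : Set 𝓢(V, ℂ)), f b = 0 := by
    intro b hb
    by_contra hne
    have hsmul : ∀ c : ℂ, c • b ∈ closure (M : Set 𝓢(V, ℂ)) := fun c => by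
      have : c • b ∈ M.topologicalClosure := M.topologicalClosure.smul_mem c (by
        rw [← SetLike.mem_coe, Submodule.topologicalClosure_coe]; exact hb)
      rwa [← SetLike.mem_coe, Submodule.topologicalClosure_coe] at this
    set c : ℂ := ((u - 1) / ‖f b‖ ^ 2 : ℝ) * conj (f b) with hc
    have h := hfb (c • b) (hsmul c)
    rw [map_smul, smul_eq_mul, hc, mul_assoc, Complex.conj_mul' (f b)] at h
    have hre : (((u - 1) / ‖f b‖ ^ 2 : ℝ) * ((‖f b‖ : ℂ) ^ 2) : ℂ).re = u - 1 := by
      have hn : ‖f b‖ ≠ 0 := norm_ne_zero_iff.2 hne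
      rw [← Complex.ofReal_pow, ← Complex.ofReal_mul, Complex.ofReal_re]
      field_simp
    rw [RCLike.re_eq_complex_re, hre] at h
    linarith
  refine ⟨f, hzero, fun hfx0 => ?_⟩
  rw [hfx0] at hfx
  simp at hfx
  linarith

/-! ### The Fourier–Laplace transform of a functional and the transforms of test functions -/

/-- `fourierInvDual (u ∘ 𝓕) = u`. [folklore] -/
theorem fourierInvDual_comp_fourierTransformCLM {ι : Type*} [Fintype ι]
    (u : 𝓢(EuclideanSpace ℝ ι, ℂ) →L[ℂ] ℂ) :
    fourierInvDual (u.comp (SchwartzMap.fourierTransformCLM ℂ)) = u := by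
  ext ψ
  simp only [fourierInvDual, ContinuousLinearMap.comp_apply, SchwartzMap.fourierTransformCLM_apply]
  congr 1
  exact FourierTransform.fourier_fourierInv_eq ψ

/-- **A functional applied to a Laplace transform is the Euclidean integral of its
Fourier–Laplace transform**: `W(g̃) = ∫ g(x) Φ(euclidUncurry x) dx` with
`Φ = fourierLaplaceFun ((W ∘ unflatten) ∘ 𝓕) R` (the exchange `clm_laplaceTest`; OS I (1973),
(8.8) in several variables). [cite: OsterwalderSchraderCMP1973, Lemma 8.2 eq. (8.8)] -/
theorem clm_laplaceTestR_eq_integral (W : 𝓢((Fin m → SpaceTime d), ℂ) →L[ℂ] ℂ)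
    {g : 𝓢((Fin m → SpaceTime d), ℂ)} (hg : g ∈ osTestSet d m) :
    W (laplaceTestR d m g) = ∫ x, g x *
      fourierLaplaceFun (((W.comp (unflattenCLM d m)).comp (SchwartzMap.fourierTransformCLM ℂ)))
        (flatOsMomentumSet d m) (euclidUncurry d m x) := by
  rw [laplaceTestR, ← ContinuousLinearMap.comp_apply,
    clm_laplaceTest _ (g.smooth ⊤) hg.1 (hg.2.trans timeOrderedRegion_subset_laplaceDomain_os)]
  refine integral_congr_ae (Eventually.of_forall fun x => ?_)
  dsimp only
  rw [fourierLaplaceFun_apply, fourierInvDual_comp_fourierTransformCLM]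

/-! ### The density theorem -/

/-- **Osterwalder–Schrader I, Lemma 4.1 (density of the Laplace transforms), in the tree's form**:
for every Schwartz function `ψ` on `(ℝ^{1+d})ᵐ`, `χ_R · ψ` lies in the closure of the span of
the Laplace transforms `g̃` of the smooth test functions `g` compactly supported in the positive
time-ordered region. See the module docstring for the proof (Hahn–Banach, Fourier–Laplace
transform of the annihilator, identity theorem from Euclidean points, boundary limit).
[cite: OsterwalderSchraderCMP1973, §4.3 Lemma 4.1 and §8 Lemma 8.2] -/
theorem cutoffR_mem_closure_laplaceSpan (ψ : 𝓢((Fin m → SpaceTime d), ℂ)) :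
    cutoffR d m ψ ∈ closure (laplaceSpan d m : Set 𝓢((Fin m → SpaceTime d), ℂ)) := by
  by_contra hψ
  obtain ⟨W, hW0, hWψ⟩ := exists_clm_eq_zero_of_notMem (laplaceSpan d m) hψ
  -- the flattened functional and its Fourier–Laplace transform
  obtain ⟨u, hu⟩ : ∃ u : 𝓢(EuclideanSpace ℝ (Fin m × Fin (d + 1)), ℂ) →L[ℂ] ℂ,
      u = W.comp (unflattenCLM d m) := ⟨_, rfl⟩
  obtain ⟨T₁, hT₁⟩ : ∃ T₁ : 𝓢(EuclideanSpace ℝ (Fin m × Fin (d + 1)), ℂ) →L[ℂ] ℂ,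
      T₁ = u.comp (SchwartzMap.fourierTransformCLM ℂ) := ⟨_, rfl⟩
  have huT : fourierInvDual T₁ = u := by rw [hT₁]; exact fourierInvDual_comp_fourierTransformCLM u
  obtain ⟨R, hR⟩ : ∃ R : Set (EuclideanSpace ℝ (Fin m × Fin (d + 1))), R = flatOsMomentumSet d m :=
    ⟨_, rfl⟩
  obtain ⟨Φ, hΦ⟩ : ∃ Φ : (Fin m × Fin (d + 1) → ℂ) → ℂ, Φ = fourierLaplaceFun T₁ R := ⟨_, rfl⟩
  have hdiff : DifferentiableOn ℂ Φ {z | imVec z ∈ interior (polarCone R)} := by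
    rw [hΦ]; exact differentiableOn_fourierLaplaceFun T₁ R
  -- `W(g̃) = ∫ g Φ(ι ·)` for the test functions
  have hval : ∀ g : 𝓢((Fin m → SpaceTime d), ℂ), g ∈ osTestSet d m →
      W (laplaceTestR d m g) = ∫ x, g x * Φ (euclidUncurry d m x) := fun g hg => by
    rw [clm_laplaceTestR_eq_integral W hg, ← hu, ← hT₁, ← hR, ← hΦ]
  -- `Φ` vanishes at the positive time-ordered Euclidean points
  have hΦE : ∀ x ∈ timeOrderedRegion d m, Φ (euclidUncurry d m x) = 0 := by
    have hcont : ContinuousOn (fun x : Fin m → SpaceTime d => Φ (euclidUncurry d m x)) (timeOrderedRegion d m) :=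
      hdiff.continuousOn.comp (euclidUncurry d m).continuous.continuousOn
        fun x hx => by rw [hR]; exact timeOrderedRegion_subset_laplaceDomain_os hx
    have h := eqOn_of_integral_mul_eq_of_isOpen isOpen_timeOrderedRegion hcont
      (continuousOn_const (c := (0 : ℂ))) fun F hF hFc => by
        have hWF : W (laplaceTestR d m F) = 0 :=
          hW0 _ (subset_closure (Submodule.subset_span ⟨F, ⟨hFc, hF⟩, rfl⟩))
        have h1 : (∫ x, Φ (euclidUncurry d m x) * F x) = ∫ x, F x * Φ (euclidUncurry d m x) :=
          integral_congr_ae (Eventually.of_forall fun x => mul_comm _ _)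
        rw [h1, ← hval F ⟨hFc, hF⟩, hWF]
        simp
    exact fun x hx => h hx
  -- hence on the forward tube
  have hΦT : EqOn (fun z => Φ (configUncurry d m z)) 0 (forwardTube d m) := by
    refine eqOn_zero_forwardTube_of_euclidean ?_ fun x hx => hΦE x hx
    refine hdiff.comp (configUncurry d m).differentiable.differentiableOn fun z hz => ?_
    show imVec (configUncurry d m z) ∈ interior (polarCone R)
    rw [show imVec (configUncurry d m z) = (WithLp.toLp 2 fun i => (configUncurry d m z i).im) from rfl,
      toLp_im_configUncurry, hR]
    exact flattenCLE_mem_interior_polarCone_osMomentumSet ((mem_forwardTube_iff_imPart_mem_tubeCone z).1 hz)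
  -- hence along the rays over a direction of the base cone
  have hηc : (fun k : Fin m => (((k : ℕ) : ℝ) + 1) • e₀ d) ∈ tubeCone d m := stdDirection_mem_tubeCone
  have hy : flattenCLE d m (fun k : Fin m => (((k : ℕ) : ℝ) + 1) • e₀ d) ∈ interior (polarCone R) := by
    rw [hR]; exact flattenCLE_mem_interior_polarCone_osMomentumSet hηc
  have hray : ∀ (x' : EuclideanSpace ℝ (Fin m × Fin (d + 1))) (t : ℝ), 0 < t →
      fourierLaplaceFun T₁ R (rayPoint x' (flattenCLE d m fun k : Fin m => (((k : ℕ) : ℝ) + 1) • e₀ d) t) = 0 :=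
    fun x' t ht => by
    have h := hΦT (mem_forwardTube_of_mem_tubeCone ((flattenCLE d m).symm x') _ hηc ht)
    simp only [configUncurry_ray, ContinuousLinearEquiv.apply_symm_apply, Pi.zero_apply, hΦ] at h
    exact h
  -- so `W (χ_R ψ) = 0`, a contradiction
  have h0 : u (SchwartzMap.smulLeftCLM ℂ (fun ξ => (coneCutoff R ξ : ℂ)) (flattenTest ψ)) = 0 := by
    rw [← huT]
    exact fourierInvDual_smulLeft_coneCutoff_eq_zero T₁ R hy hray _
  refine hWψ ?_
  rw [cutoffR_eq_unflattenCLM, ← hR, ← ContinuousLinearMap.comp_apply, ← hu]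
  exact h0

/-! ### The image of the test functions is a subspace; density in the image -/

/-- The exponential weight at Euclidean points depends continuously on the configuration. [folklore] -/
theorem continuous_exp_expForm_euclidUncurry (ξ : Fin m → SpaceTime d) :
    Continuous fun x : Fin m → SpaceTime d => exp (expForm (euclidUncurry d m x) (flattenCLE d m ξ)) := by
  have hc : ∀ (k : Fin m) (μ : Fin (d + 1)), Continuous fun x : Fin m → SpaceTime d => ((x k μ : ℝ) : ℂ) :=
    fun k μ => Complex.continuous_ofReal.comp
      ((EuclideanSpace.proj μ).continuous.comp (continuous_apply k))
  simp only [expForm_euclidUncurry]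
  refine Complex.continuous_exp.comp (continuous_const.mul (continuous_finsetSum _ fun k _ => ?_))
  exact ((continuous_const.mul (hc k 0)).mul continuous_const).add
    (continuous_finsetSum _ fun μ _ => (hc k μ.succ).mul continuous_const)

/-- The integrand of the raw transform of a compactly supported test function is integrable.
[folklore] -/
theorem integrable_mul_exp_expForm {g : 𝓢((Fin m → SpaceTime d), ℂ)}
    (hgc : HasCompactSupport (g : (Fin m → SpaceTime d) → ℂ)) (ξ : Fin m → SpaceTime d) :
    Integrable fun x : Fin m → SpaceTime d =>
      g x * exp (expForm (euclidUncurry d m x) (flattenCLE d m ξ)) :=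
  (g.continuous.mul (continuous_exp_expForm_euclidUncurry ξ)).integrable_of_hasCompactSupport
    hgc.mul_right

/-- `0 ∈ osTestSet`. [folklore] -/
theorem zero_mem_osTestSet : (0 : 𝓢((Fin m → SpaceTime d), ℂ)) ∈ osTestSet d m := by
  refine ⟨HasCompactSupport.zero, ?_⟩
  intro x hx
  have : tsupport ((0 : 𝓢((Fin m → SpaceTime d), ℂ)) : (Fin m → SpaceTime d) → ℂ) = ∅ := by
    rw [FunLike.coe_zero, tsupport_zero]
  rw [this] at hx
  exact hx.elim

/-- `osTestSet` is closed under addition. [folklore] -/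
theorem add_mem_osTestSet {f g : 𝓢((Fin m → SpaceTime d), ℂ)} (hf : f ∈ osTestSet d m)
    (hg : g ∈ osTestSet d m) : f + g ∈ osTestSet d m :=
  ⟨hf.1.add hg.1, (tsupport_add (f : (Fin m → SpaceTime d) → ℂ) g).trans (union_subset hf.2 hg.2)⟩

/-- `osTestSet` is closed under scalar multiplication. [folklore] -/
theorem smul_mem_osTestSet (c : ℂ) {g : 𝓢((Fin m → SpaceTime d), ℂ)} (hg : g ∈ osTestSet d m) :
    c • g ∈ osTestSet d m := by
  refine ⟨hg.1.smul_left, ?_⟩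
  exact (tsupport_smul_subset_right (fun _ : Fin m → SpaceTime d => c) (g : (Fin m → SpaceTime d) → ℂ)).trans hg.2

/-- The raw transform is additive on compactly supported test functions. [folklore] -/
theorem rawLaplace_add {f g : 𝓢((Fin m → SpaceTime d), ℂ)}
    (hfc : HasCompactSupport (f : (Fin m → SpaceTime d) → ℂ))
    (hgc : HasCompactSupport (g : (Fin m → SpaceTime d) → ℂ)) (ξ : Fin m → SpaceTime d) :
    rawLaplace d m (⇑(f + g)) ξ = rawLaplace d m f ξ + rawLaplace d m g ξ := by
  simp only [rawLaplace, add_apply, add_mul]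
  exact integral_add (integrable_mul_exp_expForm hfc ξ) (integrable_mul_exp_expForm hgc ξ)

/-- The raw transform is homogeneous. [folklore] -/
theorem rawLaplace_smul (c : ℂ) (g : (Fin m → SpaceTime d) → ℂ) (ξ : Fin m → SpaceTime d) :
    rawLaplace d m (fun x => c * g x) ξ = c * rawLaplace d m g ξ := by
  simp only [rawLaplace, mul_assoc]
  exact integral_const_mul c _

/-- **The Laplace transform is additive on `osTestSet`.** [folklore] -/
theorem laplaceTestR_add {f g : 𝓢((Fin m → SpaceTime d), ℂ)} (hf : f ∈ osTestSet d m)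
    (hg : g ∈ osTestSet d m) :
    laplaceTestR d m (⇑(f + g)) = laplaceTestR d m f + laplaceTestR d m g := by
  have hfg := add_mem_osTestSet hf hg
  ext ξ
  rw [add_apply, laplaceTestR_apply ((f + g).smooth ⊤) hfg.1 hfg.2,
    laplaceTestR_apply (f.smooth ⊤) hf.1 hf.2, laplaceTestR_apply (g.smooth ⊤) hg.1 hg.2,
    rawLaplace_add hf.1 hg.1]
  ring

/-- **The Laplace transform is homogeneous on `osTestSet`.** [folklore] -/
theorem laplaceTestR_smul (c : ℂ) {g : 𝓢((Fin m → SpaceTime d), ℂ)} (hg : g ∈ osTestSet d m) :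
    laplaceTestR d m (⇑(c • g)) = c • laplaceTestR d m g := by
  have hcg := smul_mem_osTestSet c hg
  ext ξ
  rw [smul_apply, laplaceTestR_apply ((c • g).smooth ⊤) hcg.1 hcg.2,
    laplaceTestR_apply (g.smooth ⊤) hg.1 hg.2, smul_eq_mul]
  have : ((c • g : 𝓢((Fin m → SpaceTime d), ℂ)) : (Fin m → SpaceTime d) → ℂ) = fun x => c * g x := by
    funext x; rfl
  rw [this, rawLaplace_smul]
  ring

/-- The Laplace transform of `0` is `0`. [folklore] -/
theorem laplaceTestR_zero : laplaceTestR d m (⇑(0 : 𝓢((Fin m → SpaceTime d), ℂ))) = 0 := by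
  have h := laplaceTestR_smul (d := d) (m := m) 0 zero_mem_osTestSet
  simpa using h

variable (d m) in
/-- **The Laplace transforms of the test functions form a subspace** `𝒮̃` of `𝓢((ℝ^{1+d})ᵐ)`
(OS I (1973), Lemma 4.1: the image of the linear map `f ↦ f̃`). [cite: OsterwalderSchraderCMP1973, §4.3 Lemma 4.1] -/
def laplaceSubmodule : Submodule ℂ 𝓢((Fin m → SpaceTime d), ℂ) where
  carrier := (fun g : 𝓢((Fin m → SpaceTime d), ℂ) => laplaceTestR d m g) '' osTestSet d m
  zero_mem' := ⟨0, zero_mem_osTestSet, laplaceTestR_zero⟩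
  add_mem' := by
    rintro _ _ ⟨f, hf, rfl⟩ ⟨g, hg, rfl⟩
    exact ⟨f + g, add_mem_osTestSet hf hg, laplaceTestR_add hf hg⟩
  smul_mem' := by
    rintro c _ ⟨g, hg, rfl⟩
    exact ⟨c • g, smul_mem_osTestSet c hg, laplaceTestR_smul c hg⟩

/-- The span is the image. [folklore] -/
theorem laplaceSpan_le_laplaceSubmodule : laplaceSpan d m ≤ laplaceSubmodule d m :=
  Submodule.span_le.2 fun _ hx => hx

/-- **Density in sequence form** (OS I (1973), Lemma 4.1, as used in (4.26)–(4.27)): for every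
Schwartz `ψ` on `(ℝ^{1+d})ᵐ` there is a sequence of smooth test functions `gₖ`, compactly supported
in the positive time-ordered region, whose Laplace transforms `g̃ₖ` converge to `χ_R · ψ` in
`𝓢((ℝ^{1+d})ᵐ)`. [cite: OsterwalderSchraderCMP1973, §4.3 Lemma 4.1] -/
theorem exists_seq_tendsto_laplaceTestR (ψ : 𝓢((Fin m → SpaceTime d), ℂ)) :
    ∃ g : ℕ → 𝓢((Fin m → SpaceTime d), ℂ), (∀ k, g k ∈ osTestSet d m) ∧
      Tendsto (fun k => laplaceTestR d m (g k)) atTop (𝓝 (cutoffR d m ψ)) := by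
  have hmem : cutoffR d m ψ ∈ closure ((laplaceSubmodule d m : Submodule ℂ _) : Set 𝓢((Fin m → SpaceTime d), ℂ)) :=
    closure_mono (fun x hx => laplaceSpan_le_laplaceSubmodule hx) (cutoffR_mem_closure_laplaceSpan ψ)
  obtain ⟨x, hx, hlim⟩ := mem_closure_iff_seq_limit.1 hmem
  choose g hg hgx using hx
  refine ⟨g, hg, ?_⟩
  simpa only [hgx] using hlim

end Literature.MathematicalPhysics.QuantumFieldTheory
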